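import Literature.MathematicalPhysics.QuantumFieldTheory.Balaban1983to89.B11Eq115Space

/-!
# `Balaban1983to89.B11Eq115KernelOp` — T. Bałaban, *The variational problem and background fields in renormalization group
# method for lattice gauge theories*, Commun. Math. Phys. **102** (1985) 277–309 [Balaban1985Variational]: OPERATORS GIVEN BY
# LATTICE KERNELS between the sizes |·|_{(−n)} and the space (115) — the passage «kernel bound ⟹ norm bound» behind (46) p. 285,
# (117) p. 295 («By Theorem 3.13 of [5] the norm max{|·|_{(−1)}, |∇·|_{(−2)}} of the transformation can be estimated by B₀|J|_{(−3)} + …»)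
# and (130) p. 298, typed over the concrete carriers `NegSup` / `JetSup` of `B11Eq115Space`

statement-level skeleton of published theorems with citation tags; proofs where landed; nothing here is a claim about the
Yang–Mills mass gap

WHY THIS FILE (cell context).  The pub-balaban NE9 owner's «INTERFACE REQUEST NE9» (HOME/INBOX.md [NE9P1-G76-RESULT], 2026-08-21) asks for
the operators (L2) `frakG`, (L4) `Hop`, (L6) `H1` of [Balaban1985Variational] (110)–(111), (45)–(46), (103) as continuous linear maps INTO the
space (115) over the concrete carriers of `B11Eq115Space` (p285053) with `∇ = covGrad …` of `B9Eq33CovDerivVector` (p285078).  In print each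
of them is an operator with a lattice KERNEL whose entries obey the inequalities of [5] = [Balaban1985BackgroundPropagators] ((3.133),
Thm 3.12 / 3.13), and each printed NORM bound ((46), (117), (130)) is obtained from the kernel inequalities by one summation against
the weights (L^jη)^n.  This file is that summation, once, for all three letters (PART A of letter (L4); PART B = `B11Eq45HOperator`).
Filed by the pub-balaban NE9 crux-team leaf seat `b2b-balaban-t4-ne9-formalise-leaf-03` (gen 52) on the owner's request (ruling (0)'s
channel); NEW file, nothing of lit-balaban's modified.

WHAT THIS FILE DOES ([folklore] functional analysis in service of the letters (L2) 𝔊, (L4) H, (L6) H₁ of the NE9∕lit-balaban letter map,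
all three of which are LINEAR OPERATORS WITH LATTICE KERNELS from a size space into the space (115)).  Over the carriers of
`B11Eq115Space` (weights `w`, `w'`, `w₀`, `w₁` positive, carried by `Fact`; fibre `V` a normed `𝕜`-space; finite index types):
* §1 `kernelLM k` — the operator `(Kf)(x) = Σ_y k(x,y)(f(y))` with an OPERATOR-VALUED kernel `k(x,y) : V →L[𝕜] W` on the flat carriers
  (print's H_{μν}(x,y′), 𝔊(x,y′) are matrices acting on the fibre 𝔤ᶜ through the parallel transporters of U₀; scalar kernels embed as
  `scalarKernel c = c • id`); `norm_kernelLM_apply_le`.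
* §2 `rowSum w w' k x = w'(x)·Σ_y ‖k(x,y)‖∕w(y)` and **`kernelCLM w w' k : NegSup w V →L[𝕜] NegSup w' W`** with
  **`norm_kernelCLM_le_of_rowSum_le`**: `(∀ x, rowSum ≤ C) → ‖K f‖_{w'} ≤ C·‖f‖_w` — KERNEL BOUND ⟹ OPERATOR BOUND (the undisplayed
  summation by which print passes from the kernel inequalities (3.133) of [5] to (46), (117), (130); cf. the tree's ℝ-valued block-norm
  reading `B11KernelDictionary.opBound_of_hasMaj`), and the operator-norm form `opNorm_kernelCLM_le`; `rowSum_le_of_pointwise` feeds the row-sum letter from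
  kernel inequalities of the printed shape `‖k(x,y)‖ ≤ w'(x)⁻¹·w(y)·e(x,y)` with `Σ_y e(x,y) ≤ C`.
* §3 **`mkJetCLM T₀ T₁ h : E →L[𝕜] JetSup w₀ w₁ ∇`** — a map into the space (115) is given by its two components `T₀ : E →L NegSup w₀ W`
  (the values) and `T₁ : E →L NegSup w₁ W` (their derivatives, `∇ ∘ T₀ = T₁`), with `‖mkJetCLM e‖ = max ‖T₀ e‖ ‖T₁ e‖`; hence
  **`kernelJetCLM`**: a kernel `k` with DERIVED kernel `k₁` (`∇(Kf) = K₁f`) defines `NegSup w V →L[𝕜] JetSup w₀ w₁ ∇` with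
  `‖K f‖ ≤ C·‖f‖` as soon as both row sums are `≤ C` (`norm_kernelJetCLM_le`) — the shape of (117)/(46): ONE constant for the max-norm.
* §4 (v1.1, APPEND-ONLY) `kernelOf T` — the kernel of a GIVEN continuous linear map between the flat carriers; `kernelLM_kernelOf` (every
  such map IS the kernel operator of its kernel), `deriv_kernelLM_kernelOf`, `norm_symm_apply_le_of_rowSum_kernelOf_le`, `jetCLMOf` +
  `norm_jetCLMOf_le` — so the algebraically-typed letters (L2) 𝔊 = G₁𝔓*, (L6) H₁ (composites of linear-map DATA) get their (117)/(103)
  bounds from the row sums of THEIR kernels, like (46) for H.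
* §5 (v1.2, APPEND-ONLY) **the kernel road is ONTO** — `jetCLMOf_flatOfJet : jetCLMOf w w₀ w₁ (flatOfJet T) ∇ ∇' h = T`: an operator ALREADY
  TYPED into (115) (`Hop`, (L2) `frakG` p288264, (L6) `B11Eq103H1Complex.H1CLM` p292856) IS the jet-kernel operator of its own kernel, so its
  (46)/(103)/(117)-type bound and the chart's radius letter follow from the row sums of THAT kernel (`norm_apply_le∕lt_of_rowSum_kernelOf`).
Nothing of the paper is asserted: the kernels are PARAMETERS; (46), (117), (130) and [5] (3.133) stay where they are (hypotheses of
`B11Eq174Chart.Regime` / `B9.Thm312Printed` / `B9.Thm313Printed`).  Net new unproved facts: 0.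
-/

noncomputable section

namespace Literature.MathematicalPhysics.QuantumFieldTheory.Balaban1983to89.B11Eq115KernelOp

open Finset
open Literature.MathematicalPhysics.QuantumFieldTheory.Balaban1983to89.B11Eq115Space

variable {ι ι' κ : Type*} {𝕜 : Type*} [NontriviallyNormedField 𝕜] {V W : Type*} [NormedAddCommGroup V] [NormedSpace 𝕜 V]
  [NormedAddCommGroup W] [NormedSpace 𝕜 W]

/-! ## §1 Kernel operators on the flat carriers -/

section Flat

variable [Fintype ι]

/-- **The operator with kernel `k`**: `(Kf)(x) = Σ_y k(x,y)(f(y))`, the entries `k(x,y) : V →L[𝕜] W` acting on the fibre (print's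
operators H, 𝔊, H₁, Δ_{U₀}H₀ … are all of this form on the finite lattices, with matrix kernels H_{μν}(x, y′) etc. built from the
transporters of the background). [cite: Balaban1985Variational, (46) p.285, (130) p.298] -/
def kernelLM (k : ι' → ι → (V →L[𝕜] W)) : (ι → V) →ₗ[𝕜] (ι' → W) where
  toFun f x := ∑ y, k x y (f y)
  map_add' f g := by
    funext x
    simp only [Pi.add_apply, map_add, sum_add_distrib]
  map_smul' c f := by
    funext x
    simp only [Pi.smul_apply, map_smul, smul_sum, RingHom.id_apply]

/-- Unfolding the kernel operator. [cite: Balaban1985Variational, (46) p.285] -/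
theorem kernelLM_apply (k : ι' → ι → (V →L[𝕜] W)) (f : ι → V) (x : ι') : kernelLM k f x = ∑ y, k x y (f y) := rfl

/-- `‖(Kf)(x)‖ ≤ Σ_y ‖k(x,y)‖·‖f(y)‖` (operator norms of the entries) — the first step of every «kernel bound ⟹ norm bound» in print.
[cite: Balaban1985Variational, (46) p.285, (130) p.298] -/
theorem norm_kernelLM_apply_le (k : ι' → ι → (V →L[𝕜] W)) (f : ι → V) (x : ι') :
    ‖kernelLM k f x‖ ≤ ∑ y, ‖k x y‖ * ‖f y‖ :=
  (norm_sum_le _ _).trans (sum_le_sum fun y _ => (k x y).le_opNorm (f y))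

/-- **Scalar kernels**: a `𝕜`-valued kernel `c(x,y)` acting by scalar multiplication, as an operator-valued one (`c(x,y)·id`) — the
tree's scalar reading (`B9SectCLatticeCarrier`, transporter replaced by a scalar bond field). [folklore] -/
def scalarKernel (c : ι' → ι → 𝕜) : ι' → ι → (V →L[𝕜] V) := fun x y => c x y • ContinuousLinearMap.id 𝕜 V

/-- A scalar kernel acts by `(Kf)(x) = Σ_y c(x,y)·f(y)` (the tree's scalar reading of the lattice operators). [cite: Balaban1985Variational, (46) p.285] -/
theorem kernelLM_scalarKernel_apply (c : ι' → ι → 𝕜) (f : ι → V) (x : ι') :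
    kernelLM (scalarKernel (V := V) c) f x = ∑ y, c x y • f y := by
  simp only [kernelLM_apply, scalarKernel, smul_apply, ContinuousLinearMap.id_apply]

omit [Fintype ι] in
/-- The entries of a scalar kernel have operator norm `≤ ‖c(x,y)‖`. [cite: Balaban1985Variational, (46) p.285] -/
theorem norm_scalarKernel_le (c : ι' → ι → 𝕜) (x : ι') (y : ι) : ‖scalarKernel (V := V) c x y‖ ≤ ‖c x y‖ := by
  unfold scalarKernel
  refine (norm_smul_le _ _).trans ?_
  exact mul_le_of_le_one_right (norm_nonneg _) ContinuousLinearMap.norm_id_le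

end Flat

/-! ## §2 Kernel operators between weighted sup spaces: kernel bound ⟹ operator bound -/

section Weighted

variable [Fintype ι] [Fintype ι'] (w : ι → ℝ) (w' : ι' → ℝ) [Fact (∀ i, 0 < w i)] [Fact (∀ i, 0 < w' i)]

/-- **The weighted row sum** of a kernel: `rowSum w w' k x = w'(x) · Σ_y ‖k(x,y)‖ ∕ w(y)` — the quantity that print bounds by a constant
when it sums the kernel inequalities of [5] ((3.133): `|H(x,y′)| ≤ O(1)(L^jη)^{−n}(L^{j′}η)^{−d}e^{−δd(y,y′)}`) against the weights
`(L^jη)^n`. [cite: Balaban1985Variational, (46) p.285, (130) p.298] -/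
def rowSum (k : ι' → ι → (V →L[𝕜] W)) (x : ι') : ℝ := w' x * ∑ y, ‖k x y‖ / w y

omit [Fintype ι'] in
/-- The row sums are non-negative. [cite: Balaban1985Variational, (46) p.285] -/
theorem rowSum_nonneg (k : ι' → ι → (V →L[𝕜] W)) (x : ι') : 0 ≤ rowSum w w' k x :=
  mul_nonneg ((Fact.out : ∀ i, 0 < w' i) x).le
    (sum_nonneg fun y _ => div_nonneg (norm_nonneg _) ((Fact.out : ∀ i, 0 < w i) y).le)

omit [Fintype ι'] in
/-- The pointwise estimate in the weights: `w'(x)·‖(Kf)(x)‖ ≤ rowSum(x)·‖f‖_w` — print's «on Ω_j» form of the operator bounds (46)/(130)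
before taking the sup. [cite: Balaban1985Variational, (46) p.285, (130) p.298] -/
theorem weight_mul_norm_kernelLM_apply_le (k : ι' → ι → (V →L[𝕜] W)) (f : NegSup w V) (x : ι') :
    w' x * ‖kernelLM k (NegSup.equiv w V f) x‖ ≤ rowSum w w' k x * ‖f‖ := by
  have hw' : 0 ≤ w' x := ((Fact.out : ∀ i, 0 < w' i) x).le
  have hstep : ∀ y, ‖k x y‖ * ‖NegSup.equiv w V f y‖ ≤ ‖k x y‖ / w y * ‖f‖ := fun y => by
    have hwy : 0 < w y := (Fact.out : ∀ i, 0 < w i) y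
    rw [div_mul_eq_mul_div, le_div_iff₀ hwy, mul_assoc]
    exact mul_le_mul_of_nonneg_left (by rw [mul_comm]; exact NegSup.weight_mul_norm_apply_le f y) (norm_nonneg _)
  calc w' x * ‖kernelLM k (NegSup.equiv w V f) x‖
      ≤ w' x * ∑ y, ‖k x y‖ * ‖NegSup.equiv w V f y‖ :=
        mul_le_mul_of_nonneg_left (norm_kernelLM_apply_le k _ x) hw'
    _ ≤ w' x * ∑ y, ‖k x y‖ / w y * ‖f‖ := mul_le_mul_of_nonneg_left (sum_le_sum fun y _ => hstep y) hw'
    _ = rowSum w w' k x * ‖f‖ := by rw [rowSum, ← sum_mul, mul_assoc]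

omit [Fintype ι'] in
/-- **From KERNEL INEQUALITIES to the row-sum letter**: if the entries obey a bound of the printed shape
`‖k(x,y)‖ ≤ w'(x)⁻¹ · w(y) · e(x,y)` (e.g. [5] (3.133): `|H(x,y′)| ≤ O(1)(L^{j}η)^{−1}(L^{j′}η)^{−d}e^{−δd(y,y′)}` against the weights
`w' = L^{j}η`, `w = 1`) and the residual factors sum to `Σ_y e(x,y) ≤ C` (the geometric summation `sup_y Σ_{y′} e^{−δd(y,y′)} ≤ c₁`), then
`rowSum w w' k x ≤ C`. [cite: Balaban1985Variational, (46) p.285, (130) p.298] -/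
theorem rowSum_le_of_pointwise {k : ι' → ι → (V →L[𝕜] W)} {e : ι' → ι → ℝ} {C : ℝ} {x : ι'}
    (hk : ∀ y, ‖k x y‖ ≤ (w' x)⁻¹ * w y * e x y) (he : ∑ y, e x y ≤ C) : rowSum w w' k x ≤ C := by
  have hw' : 0 < w' x := (Fact.out : ∀ i, 0 < w' i) x
  have hstep : ∀ y, w' x * (‖k x y‖ / w y) ≤ e x y := fun y => by
    have hwy : 0 < w y := (Fact.out : ∀ i, 0 < w i) y
    rw [mul_div_assoc', div_le_iff₀ hwy]
    calc w' x * ‖k x y‖ ≤ w' x * ((w' x)⁻¹ * w y * e x y) := mul_le_mul_of_nonneg_left (hk y) hw'.le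
      _ = e x y * w y := by field_simp
  calc rowSum w w' k x = ∑ y, w' x * (‖k x y‖ / w y) := by rw [rowSum, mul_sum]
    _ ≤ ∑ y, e x y := sum_le_sum fun y _ => hstep y
    _ ≤ C := he

/-- **The kernel operator as a continuous linear map between the weighted sup spaces** `|·|_w → |·|_{w'}` (bounded by the total row
sum; the sharp constant is in `norm_kernelCLM_le_of_rowSum_le`). [cite: Balaban1985Variational, (46) p.285, (117) p.295, (130) p.298] -/
def kernelCLM (k : ι' → ι → (V →L[𝕜] W)) : NegSup w V →L[𝕜] NegSup w' W :=
  LinearMap.mkContinuous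
    ((NegSup.linearEquiv 𝕜 w' (V := W)).symm.toLinearMap ∘ₗ kernelLM k ∘ₗ (NegSup.linearEquiv 𝕜 w).toLinearMap)
    (∑ x, rowSum w w' k x) fun f => by
      refine NegSup.norm_symm_le_of_pointwise (mul_nonneg (sum_nonneg fun x _ => rowSum_nonneg w w' k x) (norm_nonneg _))
        fun x => ?_
      refine (weight_mul_norm_kernelLM_apply_le w w' k f x).trans (mul_le_mul_of_nonneg_right ?_ (norm_nonneg _))
      exact single_le_sum (f := fun x => rowSum w w' k x) (fun x _ => rowSum_nonneg w w' k x) (mem_univ x)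

/-- Unfolding: `(Kf)(x) = Σ_y k(x,y)·f(y)` read through the identifications. [cite: Balaban1985Variational, (46) p.285] -/
@[simp] theorem equiv_kernelCLM_apply (k : ι' → ι → (V →L[𝕜] W)) (f : NegSup w V) (x : ι') :
    NegSup.equiv w' W (kernelCLM w w' k f) x = ∑ y, k x y (NegSup.equiv w V f y) := rfl

/-- The flat reading: `equiv (K f) = kernelLM k (equiv f)`. [cite: Balaban1985Variational, (46) p.285] -/
theorem equiv_kernelCLM (k : ι' → ι → (V →L[𝕜] W)) (f : NegSup w V) :
    NegSup.equiv w' W (kernelCLM w w' k f) = kernelLM k (NegSup.equiv w V f) := rfl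

/-- **KERNEL BOUND ⟹ OPERATOR BOUND**: if every weighted row sum is `≤ C` then `‖Kf‖_{w'} ≤ C·‖f‖_w` — the summation by which
(46) «|HB| … ≤ b|B|», (117) «≤ B₀|J|_{(−3)}» and (130) follow from the kernel inequalities of [5].
[cite: Balaban1985Variational, (46) p.285, (117) p.295, (130) p.298] -/
theorem norm_kernelCLM_le_of_rowSum_le {k : ι' → ι → (V →L[𝕜] W)} {C : ℝ} (hC0 : 0 ≤ C) (hC : ∀ x, rowSum w w' k x ≤ C)
    (f : NegSup w V) : ‖kernelCLM w w' k f‖ ≤ C * ‖f‖ :=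
  NegSup.norm_symm_le_of_pointwise (mul_nonneg hC0 (norm_nonneg _)) fun x =>
    (weight_mul_norm_kernelLM_apply_le w w' k f x).trans (mul_le_mul_of_nonneg_right (hC x) (norm_nonneg _))

/-- The operator-norm form: `‖K‖ ≤ C`. [cite: Balaban1985Variational, (46) p.285, (117) p.295] -/
theorem opNorm_kernelCLM_le {k : ι' → ι → (V →L[𝕜] W)} {C : ℝ} (hC0 : 0 ≤ C) (hC : ∀ x, rowSum w w' k x ≤ C) :
    ‖kernelCLM w w' k‖ ≤ C :=
  ContinuousLinearMap.opNorm_le_bound _ hC0 (norm_kernelCLM_le_of_rowSum_le w w' hC0 hC)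

end Weighted

/-! ## §3 Maps into the space (115): components, and kernel operators with a derived kernel -/

section Jet

variable [Fintype ι'] [Fintype κ] (w₀ : ι' → ℝ) (w₁ : κ → ℝ) (D : (ι' → W) →ₗ[𝕜] (κ → W))
  [Fact (∀ i, 0 < w₀ i)] [Fact (∀ p, 0 < w₁ p)]
  {E : Type*} [NormedAddCommGroup E] [NormedSpace 𝕜 E]

/-- **A continuous linear map INTO the space (115) from its two components**: values `T₀ : E →L |·|_{w₀}` and derivatives
`T₁ : E →L |·|_{w₁}` with `∇ ∘ T₀ = T₁`; the jet norm of the image is `max ‖T₀ e‖ ‖T₁ e‖`. [cite: Balaban1985Variational, (115) p.294, (117) p.295] -/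
def mkJetCLM
    (T₀ : E →L[𝕜] NegSup w₀ W) (T₁ : E →L[𝕜] NegSup w₁ W)
    (h : ∀ e, D (NegSup.equiv w₀ W (T₀ e)) = NegSup.equiv w₁ W (T₁ e)) : E →L[𝕜] JetSup w₀ w₁ D :=
  LinearMap.mkContinuous
    { toFun := fun e => (JetSup.equiv w₀ w₁ D).symm (NegSup.equiv w₀ W (T₀ e))
      map_add' := fun e e' => by simp only [map_add, NegSup.equiv_add]; rfl
      map_smul' := fun c e => by simp only [map_smul, NegSup.equiv_smul, RingHom.id_apply]; rfl }
    (max ‖T₀‖ ‖T₁‖) fun e => by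
      change max ‖T₀ e‖ ‖(NegSup.equiv w₁ W).symm (D (NegSup.equiv w₀ W (T₀ e)))‖ ≤ _
      rw [h]
      change max ‖T₀ e‖ ‖T₁ e‖ ≤ _
      rw [max_mul_of_nonneg _ _ (norm_nonneg e)]
      exact max_le_max (T₀.le_opNorm e) (T₁.le_opNorm e)

variable {w₀ w₁ D}

/-- The value component of `mkJetCLM T₀ T₁ h` is `T₀`. [cite: Balaban1985Variational, (115) p.294] -/
@[simp] theorem fst_mkJetCLM (T₀ : E →L[𝕜] NegSup w₀ W) (T₁ : E →L[𝕜] NegSup w₁ W)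
    (h : ∀ e, D (NegSup.equiv w₀ W (T₀ e)) = NegSup.equiv w₁ W (T₁ e)) (e : E) :
    JetSup.fst (mkJetCLM w₀ w₁ D T₀ T₁ h e) = T₀ e := rfl

/-- The derivative component of `mkJetCLM T₀ T₁ h` is `T₁`. [cite: Balaban1985Variational, (115) p.294] -/
@[simp] theorem snd_mkJetCLM (T₀ : E →L[𝕜] NegSup w₀ W) (T₁ : E →L[𝕜] NegSup w₁ W)
    (h : ∀ e, D (NegSup.equiv w₀ W (T₀ e)) = NegSup.equiv w₁ W (T₁ e)) (e : E) :
    JetSup.snd (mkJetCLM w₀ w₁ D T₀ T₁ h e) = T₁ e := by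
  change (NegSup.equiv w₁ W).symm (D (NegSup.equiv w₀ W (T₀ e))) = T₁ e
  rw [h]; rfl

/-- Reading the values pointwise. [cite: Balaban1985Variational, (115) p.294] -/
@[simp] theorem equiv_mkJetCLM_apply (T₀ : E →L[𝕜] NegSup w₀ W) (T₁ : E →L[𝕜] NegSup w₁ W)
    (h : ∀ e, D (NegSup.equiv w₀ W (T₀ e)) = NegSup.equiv w₁ W (T₁ e)) (e : E) (x : ι') :
    JetSup.equiv w₀ w₁ D (mkJetCLM w₀ w₁ D T₀ T₁ h e) x = NegSup.equiv w₀ W (T₀ e) x := rfl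

/-- **The jet norm of the image is the max of the two component norms.** [cite: Balaban1985Variational, (115) p.294, (117) p.295] -/
theorem norm_mkJetCLM_apply (T₀ : E →L[𝕜] NegSup w₀ W) (T₁ : E →L[𝕜] NegSup w₁ W)
    (h : ∀ e, D (NegSup.equiv w₀ W (T₀ e)) = NegSup.equiv w₁ W (T₁ e)) (e : E) :
    ‖mkJetCLM w₀ w₁ D T₀ T₁ h e‖ = max ‖T₀ e‖ ‖T₁ e‖ := by
  rw [JetSup.norm_def, fst_mkJetCLM, snd_mkJetCLM]

/-- ONE constant for the max-norm: `‖T₀ e‖ ≤ C‖e‖` and `‖T₁ e‖ ≤ C‖e‖` give `‖mkJetCLM e‖ ≤ C‖e‖` (print's «the norm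
max{|·|_{(−1)}, |∇·|_{(−2)}} of the transformation can be estimated by B₀|J|_{(−3)}»). [cite: Balaban1985Variational, (117) p.295] -/
theorem norm_mkJetCLM_apply_le (T₀ : E →L[𝕜] NegSup w₀ W) (T₁ : E →L[𝕜] NegSup w₁ W)
    (h : ∀ e, D (NegSup.equiv w₀ W (T₀ e)) = NegSup.equiv w₁ W (T₁ e)) {C : ℝ} {e : E}
    (h₀ : ‖T₀ e‖ ≤ C * ‖e‖) (h₁ : ‖T₁ e‖ ≤ C * ‖e‖) : ‖mkJetCLM w₀ w₁ D T₀ T₁ h e‖ ≤ C * ‖e‖ := by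
  rw [norm_mkJetCLM_apply]; exact max_le h₀ h₁

end Jet

section JetKernel

variable [Fintype ι] [Fintype ι'] [Fintype κ] (w : ι → ℝ) (w₀ : ι' → ℝ) (w₁ : κ → ℝ) (D : (ι' → W) →ₗ[𝕜] (κ → W))
  [Fact (∀ i, 0 < w i)] [Fact (∀ i, 0 < w₀ i)] [Fact (∀ p, 0 < w₁ p)]

/-- **A kernel operator INTO the space (115)**: kernel `k` (values) with DERIVED kernel `k₁` (`∇(Kf) = K₁f` on the flat carriers — on the
lattice, `k₁` is the covariant difference of `k` in its first argument), as a continuous linear map `|·|_w → (115)`; print's 𝔊 ((117)),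
H ((46)), H₁ ((103)) are of this form. [cite: Balaban1985Variational, (46) p.285, (103) p.293, (117) p.295] -/
def kernelJetCLM (k : ι' → ι → (V →L[𝕜] W)) (k₁ : κ → ι → (V →L[𝕜] W)) (hD : ∀ f : ι → V, D (kernelLM k f) = kernelLM k₁ f) :
    NegSup w V →L[𝕜] JetSup w₀ w₁ D :=
  mkJetCLM w₀ w₁ D (kernelCLM w w₀ k) (kernelCLM w w₁ k₁) fun f => hD (NegSup.equiv w V f)

/-- Reading the values of `kernelJetCLM` pointwise: `(Kf)(x) = Σ_y k(x,y)·f(y)`. [cite: Balaban1985Variational, (46) p.285] -/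
@[simp] theorem equiv_kernelJetCLM_apply (k : ι' → ι → (V →L[𝕜] W)) (k₁ : κ → ι → (V →L[𝕜] W))
    (hD : ∀ f : ι → V, D (kernelLM k f) = kernelLM k₁ f) (f : NegSup w V) (x : ι') :
    JetSup.equiv w₀ w₁ D (kernelJetCLM w w₀ w₁ D k k₁ hD f) x = ∑ y, k x y (NegSup.equiv w V f y) := rfl

/-- **KERNEL BOUNDS ⟹ THE (117)/(46)-TYPE BOUND IN THE MAX-NORM**: if the weighted row sums of `k` (against `w₀`) and of the derived
kernel `k₁` (against `w₁`) are all `≤ C`, then `‖Kf‖_{(115)} ≤ C·‖f‖_w`. [cite: Balaban1985Variational, (46) p.285, (117) p.295] -/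
theorem norm_kernelJetCLM_le {k : ι' → ι → (V →L[𝕜] W)} {k₁ : κ → ι → (V →L[𝕜] W)} (hD : ∀ f : ι → V, D (kernelLM k f) = kernelLM k₁ f)
    {C : ℝ} (hC0 : 0 ≤ C) (hC₀ : ∀ x, rowSum w w₀ k x ≤ C) (hC₁ : ∀ p, rowSum w w₁ k₁ p ≤ C) (f : NegSup w V) :
    ‖kernelJetCLM w w₀ w₁ D k k₁ hD f‖ ≤ C * ‖f‖ :=
  norm_mkJetCLM_apply_le _ _ _ (norm_kernelCLM_le_of_rowSum_le w w₀ hC0 hC₀ f) (norm_kernelCLM_le_of_rowSum_le w w₁ hC0 hC₁ f)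

/-- The operator-norm form. [cite: Balaban1985Variational, (117) p.295] -/
theorem opNorm_kernelJetCLM_le {k : ι' → ι → (V →L[𝕜] W)} {k₁ : κ → ι → (V →L[𝕜] W)} (hD : ∀ f : ι → V, D (kernelLM k f) = kernelLM k₁ f)
    {C : ℝ} (hC0 : 0 ≤ C) (hC₀ : ∀ x, rowSum w w₀ k x ≤ C) (hC₁ : ∀ p, rowSum w w₁ k₁ p ≤ C) :
    ‖kernelJetCLM w w₀ w₁ D k k₁ hD‖ ≤ C :=
  ContinuousLinearMap.opNorm_le_bound _ hC0 (norm_kernelJetCLM_le w w₀ w₁ D hD hC0 hC₀ hC₁)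

end JetKernel

/-! ## §4 (v1.1) The kernel of a GIVEN continuous linear map: every linear map between the flat carriers is a kernel operator

Added for the algebraically-typed letters ((L2) 𝔊 = G₁𝔓*, (L6) H₁ = G₁Q*(QG₁Q*)⁻¹(L^jη)⁻¹ built from linear-map DATA): their operator
bounds (117)/(103) in the weighted norms follow from the row sums of THEIR kernels exactly as (46) does for H — `kernelOf` names that kernel. -/

section KernelOf

variable [DecidableEq ι]

/-- **The kernel (matrix of fibre operators) of a continuous linear map between the flat carriers**: `kernelOf T x y = (v ↦ T(δ_y·v)(x))`
— print's `H(x, y′)`, `𝔊(x, y′)` recovered from the operator. [cite: Balaban1985Variational, (46) p.285, (130) p.298] -/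
def kernelOf (T : (ι → V) →L[𝕜] (ι' → W)) : ι' → ι → (V →L[𝕜] W) :=
  fun x y => (ContinuousLinearMap.proj x).comp (T.comp (ContinuousLinearMap.single 𝕜 (fun _ : ι => V) y))

/-- Unfolding: the `(x, y)` entry applied to `v` is `T (Pi.single y v) x`. [cite: Balaban1985Variational, (46) p.285] -/
theorem kernelOf_apply (T : (ι → V) →L[𝕜] (ι' → W)) (x : ι') (y : ι) (v : V) :
    kernelOf T x y v = T (Pi.single y v) x := rfl

variable [Fintype ι]

/-- **Every continuous linear map between the flat carriers IS the kernel operator of its kernel**: `kernelLM (kernelOf T) f = T f`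
(`f = Σ_y δ_y·f(y)` on a finite lattice). [cite: Balaban1985Variational, (46) p.285, (130) p.298] -/
theorem kernelLM_kernelOf (T : (ι → V) →L[𝕜] (ι' → W)) (f : ι → V) : kernelLM (kernelOf T) f = T f := by
  funext x
  rw [kernelLM_apply, ← congr_fun (ContinuousLinearMap.sum_comp_single 𝕜 (fun _ : ι => V) T f) x, Finset.sum_apply]
  rfl

/-- The kernel of a kernel operator's continuous extension returns the operator (reading both through `kernelLM`).
[cite: Balaban1985Variational, (46) p.285] -/
theorem kernelLM_kernelOf_eq_of_eq {T : (ι → V) →L[𝕜] (ι' → W)} {k : ι' → ι → (V →L[𝕜] W)} (h : ∀ f, T f = kernelLM k f)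
    (f : ι → V) : kernelLM (kernelOf T) f = kernelLM k f := by
  rw [kernelLM_kernelOf, h]

/-- **Derivatives commute with the kernel reading**: for a linear `∇` agreeing with a continuous `∇'`, `∇(T f) = kernelLM (kernelOf (∇' ∘ T)) f` — the
hypothesis `hD` of `kernelJetCLM` for an operator given algebraically. [cite: Balaban1985Variational, (46) p.285, (117) p.295] -/
theorem deriv_kernelLM_kernelOf (T : (ι → V) →L[𝕜] (ι' → W)) (D : (ι' → W) →ₗ[𝕜] (κ → W)) (D' : (ι' → W) →L[𝕜] (κ → W))
    (hDD' : ∀ g, D g = D' g) (f : ι → V) : D (kernelLM (kernelOf T) f) = kernelLM (kernelOf (D'.comp T)) f := by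
  rw [kernelLM_kernelOf, kernelLM_kernelOf, hDD']
  rfl

variable [Fintype ι'] (w : ι → ℝ) (w' : ι' → ℝ) [Fact (∀ i, 0 < w i)] [Fact (∀ i, 0 < w' i)]

/-- Reading `T` on the weighted sup spaces through its kernel: `kernelCLM w w' (kernelOf T)` acts as `T`. [cite: Balaban1985Variational, (46) p.285] -/
theorem equiv_kernelCLM_kernelOf (T : (ι → V) →L[𝕜] (ι' → W)) (f : NegSup w V) :
    NegSup.equiv w' W (kernelCLM w w' (kernelOf T) f) = T (NegSup.equiv w V f) := by
  rw [equiv_kernelCLM, kernelLM_kernelOf]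

/-- **An operator bound for an algebraically given `T` in the weighted norms, from the row sums of ITS kernel**:
`(∀ x, rowSum w w' (kernelOf T) x ≤ C) → ‖T f‖_{w'} ≤ C·‖f‖_w` (the letters (117) «≤ B₀|J|_{(−3)}», (103), (130) for operators typed as
composites of linear-map data). [cite: Balaban1985Variational, (117) p.295, (130) p.298] -/
theorem norm_symm_apply_le_of_rowSum_kernelOf_le {T : (ι → V) →L[𝕜] (ι' → W)} {C : ℝ} (hC0 : 0 ≤ C)
    (hC : ∀ x, rowSum w w' (kernelOf T) x ≤ C) (f : NegSup w V) :
    ‖(NegSup.equiv w' W).symm (T (NegSup.equiv w V f))‖ ≤ C * ‖f‖ := by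
  have h := norm_kernelCLM_le_of_rowSum_le w w' hC0 hC f
  rwa [← (NegSup.equiv w' W).symm_apply_apply (kernelCLM w w' (kernelOf T) f), equiv_kernelCLM_kernelOf] at h

variable [Fintype κ] (w₀ : ι' → ℝ) (w₁ : κ → ℝ) [Fact (∀ i, 0 < w₀ i)] [Fact (∀ p, 0 < w₁ p)]

/-- **An algebraically given operator INTO the space (115)**: `T` (values) with `∇` agreeing with a continuous `∇'`, as
`NegSup w V →L[𝕜] JetSup w₀ w₁ ∇` through the kernels of `T` and `∇' ∘ T`. [cite: Balaban1985Variational, (117) p.295, (46) p.285] -/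
def jetCLMOf (T : (ι → V) →L[𝕜] (ι' → W)) (D : (ι' → W) →ₗ[𝕜] (κ → W)) (D' : (ι' → W) →L[𝕜] (κ → W))
    (hDD' : ∀ g, D g = D' g) : NegSup w V →L[𝕜] JetSup w₀ w₁ D :=
  kernelJetCLM w w₀ w₁ D (kernelOf T) (kernelOf (D'.comp T)) (deriv_kernelLM_kernelOf T D D' hDD')

/-- Its values are `T`'s. [cite: Balaban1985Variational, (117) p.295] -/
theorem equiv_jetCLMOf_apply (T : (ι → V) →L[𝕜] (ι' → W)) (D : (ι' → W) →ₗ[𝕜] (κ → W)) (D' : (ι' → W) →L[𝕜] (κ → W))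
    (hDD' : ∀ g, D g = D' g) (f : NegSup w V) :
    JetSup.equiv w₀ w₁ D (jetCLMOf w w₀ w₁ T D D' hDD' f) = T (NegSup.equiv w V f) := by
  funext x
  rw [jetCLMOf, equiv_kernelJetCLM_apply, ← kernelLM_apply, kernelLM_kernelOf]

/-- **The (117)/(103)-type bound for an algebraically given operator**: both row sums (of the kernel of `T` against `w₀`, of the kernel of
`∇' ∘ T` against `w₁`) `≤ C` ⇒ `‖jetCLMOf … f‖_{(115)} ≤ C·‖f‖_w`. [cite: Balaban1985Variational, (117) p.295, (103) p.293] -/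
theorem norm_jetCLMOf_le {T : (ι → V) →L[𝕜] (ι' → W)} {D : (ι' → W) →ₗ[𝕜] (κ → W)} {D' : (ι' → W) →L[𝕜] (κ → W)}
    (hDD' : ∀ g, D g = D' g) {C : ℝ} (hC0 : 0 ≤ C) (hC₀ : ∀ x, rowSum w w₀ (kernelOf T) x ≤ C)
    (hC₁ : ∀ p, rowSum w w₁ (kernelOf (D'.comp T)) p ≤ C) (f : NegSup w V) : ‖jetCLMOf w w₀ w₁ T D D' hDD' f‖ ≤ C * ‖f‖ :=
  norm_kernelJetCLM_le w w₀ w₁ D (deriv_kernelLM_kernelOf T D D' hDD') hC0 hC₀ hC₁ f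

end KernelOf

/-! ## §5 (v1.2) The kernel road is onto: a carrier-typed operator into (115) IS the jet-kernel operator of its own kernel -/

section Onto

variable [DecidableEq ι] [Fintype ι] [Fintype ι'] [Fintype κ] (w : ι → ℝ) (w₀ : ι' → ℝ) (w₁ : κ → ℝ) (D : (ι' → W) →ₗ[𝕜] (κ → W))
  [Fact (∀ i, 0 < w i)] [Fact (∀ i, 0 < w₀ i)] [Fact (∀ p, 0 < w₁ p)]

/-- **The values of a continuous linear map into (115), as a map of the FLAT carriers**: `flatOfJet T f x = (T f)(x)` (by `rfl`:
`= JetSup.equiv w₀ w₁ D (T ((NegSup.equiv w V).symm f)) x`). [cite: Balaban1985Variational, (115) p.294] -/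
def flatOfJet (T : NegSup w V →L[𝕜] JetSup w₀ w₁ D) : (ι → V) →L[𝕜] (ι' → W) :=
  (ContinuousLinearMap.pi fun x => JetSup.evalCLM w₀ w₁ D x).comp (T.comp (NegSup.continuousLinearEquiv 𝕜 w).symm.toContinuousLinearMap)

/-- **THE KERNEL ROAD IS ONTO**: for every continuous linear `T : |·|_w → (115)` and any continuous copy `∇'` of `∇`, `T` IS the jet-kernel
operator of the kernel of its values (print's 𝔊(x,y′), H(x,y′) recovered from the typed operators). [cite: Balaban1985Variational, (46) p.285, (117) p.295] -/
theorem jetCLMOf_flatOfJet (T : NegSup w V →L[𝕜] JetSup w₀ w₁ D) (D' : (ι' → W) →L[𝕜] (κ → W)) (hDD' : ∀ g, D g = D' g) :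
    jetCLMOf w w₀ w₁ (flatOfJet w w₀ w₁ D T) D D' hDD' = T :=
  ContinuousLinearMap.ext fun f => (JetSup.equiv w₀ w₁ D).injective (by rw [equiv_jetCLMOf_apply]; rfl)

/-- **The (46)/(103)/(117)-type bound of ANY carrier-typed operator from the row sums of ITS kernel**: row sums of `kernelOf (flatOfJet T)`
(against `w₀`) and of `kernelOf (∇' ∘ flatOfJet T)` (against `w₁`) `≤ C` ⇒ `‖T f‖_{(115)} ≤ C·‖f‖_w`. [cite: Balaban1985Variational, (46) p.285, (117) p.295] -/
theorem norm_apply_le_of_rowSum_kernelOf {T : NegSup w V →L[𝕜] JetSup w₀ w₁ D} (D' : (ι' → W) →L[𝕜] (κ → W))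
    (hDD' : ∀ g, D g = D' g) {C : ℝ} (hC0 : 0 ≤ C) (hC₀ : ∀ x, rowSum w w₀ (kernelOf (flatOfJet w w₀ w₁ D T)) x ≤ C)
    (hC₁ : ∀ p, rowSum w w₁ (kernelOf (D'.comp (flatOfJet w w₀ w₁ D T))) p ≤ C) (f : NegSup w V) : ‖T f‖ ≤ C * ‖f‖ := by
  simpa only [jetCLMOf_flatOfJet] using norm_jetCLMOf_le w w₀ w₁ hDD' hC0 hC₀ hC₁ f

/-- The same with `∇`'s continuous copy supplied by finite dimension. [cite: Balaban1985Variational, (46) p.285, (103) p.293, (117) p.295] -/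
theorem norm_apply_le_of_rowSum_kernelOf' [CompleteSpace 𝕜] [FiniteDimensional 𝕜 W]
    {T : NegSup w V →L[𝕜] JetSup w₀ w₁ D} {C : ℝ} (hC0 : 0 ≤ C) (hC₀ : ∀ x, rowSum w w₀ (kernelOf (flatOfJet w w₀ w₁ D T)) x ≤ C)
    (hC₁ : ∀ p, rowSum w w₁ (kernelOf ((LinearMap.toContinuousLinearMap D).comp (flatOfJet w w₀ w₁ D T))) p ≤ C) (f : NegSup w V) :
    ‖T f‖ ≤ C * ‖f‖ :=
  norm_apply_le_of_rowSum_kernelOf w w₀ w₁ D (LinearMap.toContinuousLinearMap D) (fun _ => rfl) hC0 hC₀ hC₁ f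

/-- **The chart's radius letter** `‖T f‖ < a` on `‖f‖ < R` (`hRb` of the (174) chart) from the row sums and `C·R ≤ a`. [cite: Balaban1985Variational, (174) p.305] -/
theorem norm_apply_lt_of_rowSum_kernelOf [CompleteSpace 𝕜] [FiniteDimensional 𝕜 W] {T : NegSup w V →L[𝕜] JetSup w₀ w₁ D} {C a R : ℝ}
    (hC : 0 < C) (hC₀ : ∀ x, rowSum w w₀ (kernelOf (flatOfJet w w₀ w₁ D T)) x ≤ C)
    (hC₁ : ∀ p, rowSum w w₁ (kernelOf ((LinearMap.toContinuousLinearMap D).comp (flatOfJet w w₀ w₁ D T))) p ≤ C) (hRa : C * R ≤ a)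
    {f : NegSup w V} (hf : ‖f‖ < R) : ‖T f‖ < a :=
  (norm_apply_le_of_rowSum_kernelOf' w w₀ w₁ D hC.le hC₀ hC₁ f).trans_lt ((mul_lt_mul_of_pos_left hf hC).trans_le hRa)

end Onto

end Literature.MathematicalPhysics.QuantumFieldTheory.Balaban1983to89.B11Eq115KernelOp

end
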